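import Literature.MathematicalPhysics.QuantumFieldTheory.Balaban1983to89.Beta.RemainderDecay190SupNorm
import Literature.MathematicalPhysics.QuantumFieldTheory.Balaban1983to89.Beta.RemainderKernelPeriodised
import Literature.MathematicalPhysics.QuantumFieldTheory.Balaban1983to89.Beta.RemainderKernelDecay

/-!
# [Balaban1985Variational] (190) p. 308 on the (4.4)-space MODEL of [Balaban1987RG1] p. 282 WITHOUT A SECT. G LETTER:
# the (190)-socket `Data190` of row (D4) INHABITED on the cube torus from ONE periodised decaying ℤ^d kernel — and from
# four periodised decaying pieces assembled by (182) (`Beta.RemainderDecay190Periodised`)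

statement-level skeleton of published theorems with citation tags; proofs where landed; nothing here is a claim
about the Yang–Mills mass gap.

HONEST FRAMING (cell rule).  Bookkeeping for the k-uniform remainder chain of row (D4) (`RemainderConst` ⇐ ONE
`ChainTFac190` instance, `Beta.RemainderDecay190`); discharges NOTHING of `BetaPertH`; NOT B12 Thm 2, NOT the continuum
limit, NOT Clay.  Unit `b2b-balaban-beta-an4` gen 96 (BINDER row D4 OWNER; cell pub-balaban).  Imports
`Beta.RemainderDecay190SupNorm` (generation 94: the (4.4)-space model, `normDominated_restrictC_ofBlocks`, and through
it generation 93's dictionary letters), `Beta.RemainderKernelPeriodised` (`entry_eq182`) and `Beta.RemainderKernelDecay`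
(`decay₂_eq182`) ONLY; nothing edited.

WHAT.  Generations 91–94 inhabit the (190)-socket `Data190 d M N (fun n => TPt d (N n·M) → ℂ) q` on the cube-torus block
carrier from the per-torus SECT. G LETTERS of [15] — majorants of G̃, (189), Δ⁽²⁾𝐇₀, 𝐇₀, 𝐇_k, 𝔇, the carriers (184) ∕
(188) ∕ (182), the Neumann ratio of (187) (`RemainderDecay190SupNorm.exists_data190_of_sectG_cubes_supNorm`) — the
road print takes at a GENERAL background field.  On the MODEL of this lineage's NODE E (generation 95:
`RemainderKernelPeriodised`, `RemainderKernelDecay`; generation 96: `RemainderDecay190SupNormPieces`) the kernel of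
(δ𝐇∕δB)_n is the periodisation of a decaying ℤ^d kernel — and THEN (190) needs no Sect. G letter at all:
* §1 **`abs_periodise₂_le_of_decay`** — a block-periodic ℤ^d kernel with `|K(x,y)| ≤ C e^{−δ|x−y|₁}`, `δ > 0`, has a
  periodisation decaying in the PERIODIC ℓ¹ distance of the torus: `|K̂(a,b)| ≤ C·K₁(d, δ∕2)·e^{−(δ∕2)‖a − b‖}` (sum over
  the images; half the rate pays for the image sum, [Balaban1984PropagatorsI] p. 36 *"relating G on the torus to G on
  the whole lattice in the usual way"*).
* §2 **`hasMaj_ofBlocks_cubes_of_entry_decay`** — an operator on the torus fields whose matrix entries decay in the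
  periodic ℓ¹ distance, `|T(δ_b)(a)| ≤ C₁ e^{−ρ‖a − b‖}`, `ρ > 0`, has the BLOCK MAJORANT
  `C₁·K₁(d, ρ∕2)·e^{−(ρ∕2) d₁(y,y′)}` between the sharp cube sup-sizes of the cube torus (cubes of side `M`, read in
  `Π_i Fin N` by the canonical identification ê of generation 93; `d₁` = `B9Thm37GlueTorus.tdist1`): the cube distance is
  dominated by the site distance (`B12Decay510Torus.pl1_tcubeOf_sub_le_distCT`, `distCT_le`, `tdist1_finOfVal_eq_pl1`)
  and the row sum over a cube by the torus sum `Σ_w e^{−(ρ∕2)‖w‖} ≤ K₁(d, ρ∕2)` (`sum_exp_pl1_le_K₁`); then the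
  conservativity `B11SectG.hasMaj_of_hasMajorant`.  `ineq190_ofBlocks_cubes_of_entry_decay` reads it as the (190) letter
  `Ineq190 … Cst δ15` for any `δ15 ≤ 4ρ`, `Cst ≥ C₁·K₁(d, ρ∕2)`.
* §3 **`exists_data190_of_entry_cubes_supNorm`** — THE (190)-SOCKET ON THE MODEL FROM ONE ENTRYWISE DECAY STATEMENT:
  generation 94's join certificate on the cube torus with its `h190` REPLACED by §2 — inputs: the kernel family `dH n`
  with `|dH n(δ_b)(a)| ≤ C₁ e^{−ρ‖a − b‖}` on every torus, and numerics ONLY (`0 < q.σ`, a row-sum reference rate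
  `δr > 0` with `c₀(q.σ∕δr)^d ≤ q.cR`, `1 ≤ q.κB`, `1 ≤ q.m`, `0 ≤ q.θ`, `q.θ·M ≤ 1`, `q.δ15 ≤ 4ρ`,
  `C₁·K₁(d, ρ∕2) ≤ q.Cst`); output `∃ D : Data190 …` with the (4.35) computation rule exposed, exactly as generation 94.
* §4 **`exists_data190_of_periodised_cubes_supNorm`** (ONE block-periodic decaying ℤ^d kernel `S` with the entry shape:
  §1 + §3) and **`exists_data190_of_pieces182_cubes_supNorm`** (FOUR pieces by (182): `entry_eq182` + `decay₂_eq182`).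
AFTER THIS FILE, on the model carrier, NODE D (the p. 282 decay leaf ∕ (190)) and NODE E (the kernel letters `hker` ∕
`hS` ∕ `hdec`, generation 95–96) are fed by ONE AND THE SAME object-level datum: four ℤ^d kernels with block
periodicity and exponential decay, four torus operator families acting entrywise as their periodisations, and (182).
HONEST ACCOUNTING: in [15] the decay of 𝔄₀ = (δ∕δB)𝒜₀ is DERIVED from (184) by the Neumann series (188) and the
author-omitted kernel bound (189) (cell GAPS G-B11-G2); on THIS road the decay of the piece `a₀` is an INPUT — that is
where (188)–(189) went; nothing of (189) is discharged.  WHAT IS *NOT* DONE: no operator of Bałaban's is constructed;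
that HIS zero-background 𝔄₀, 𝐇₀, 𝐇_k, 𝔇 are periodisations of decaying ℤ^d kernels is NODE O's statement; row D4
class UNCHANGED (instance 0∕1; critical-path width 0 = NODE O; D4 DISCHARGE NO DATE).  No `def`, no named fact, no
`sorry`, standard axioms.  HONEST DEPENDENCY: continuum YM on T⁴ ⇐ BetaPertH ∧ nine spine estimates (0/9 proved);
BetaPertH ⇐ (D1) ∧ (D4) ∧ CAP+tail; G-an2-4 gates asym, D1 and NE2/3/4.

Sources: [15] = T. Bałaban, Commun. Math. Phys. **102** (1985) 277–309 [Balaban1985Variational], (182) p. 307, (189)–(190)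
p. 308; [I] = Commun. Math. Phys. **109** (1987) 249–301 [Balaban1987RG1], (4.4) p. 281, p. 282, (5.10) p. 293; [3] = Commun.
Math. Phys. **96** (1984) 223–250 [Balaban1984PropagatorsII], (2.46), (2.51), (2.61); [Balaban1984PropagatorsI] p. 36.
-/

namespace Literature.MathematicalPhysics.QuantumFieldTheory.Balaban1983to89.Beta.RemainderDecay190Periodised

open Literature.MathematicalPhysics.QuantumFieldTheory.Balaban1983to89 B11SectG B6RandomWalk
open Literature.MathematicalPhysics.QuantumFieldTheory.Balaban1983to89.B9Thm34Ext (toB6)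
open Literature.MathematicalPhysics.QuantumFieldTheory.Balaban1983to89.B9Thm37GlueTorus (torusGeom tdist1 tdist1_nonneg)
open Literature.MathematicalPhysics.QuantumFieldTheory.Balaban1983to89.B5TorusCover (UT)
open Literature.MathematicalPhysics.QuantumFieldTheory.Balaban1983to89.B13ScaleTransfer (Pt)
open Literature.MathematicalPhysics.QuantumFieldTheory.Balaban1983to89.TreeLengthTorus (TPt TDom proj)
open Literature.MathematicalPhysics.QuantumFieldTheory.Balaban1983to89.B12Sec2to5 (l1 l1_nonneg summable_exp_neg_l1)
open Literature.MathematicalPhysics.QuantumFieldTheory.Balaban1983to89.B12Decay510Window (K₁ K₁_nonneg)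
open Literature.MathematicalPhysics.QuantumFieldTheory.Balaban1983to89.B12Decay510Torus
  (pl1 pl1_nonneg pl1_proj_le_l1 vmaVec proj_vmaVec proj_sub tcubeOf distCT_le pl1_tcubeOf_sub_le_distCT
    sum_exp_pl1_le_K₁)
open Literature.MathematicalPhysics.QuantumFieldTheory.Balaban1983to89.Beta.RemainderDecay190 (Data190 Consts190)
open Literature.MathematicalPhysics.QuantumFieldTheory.Balaban1983to89.Beta
  (Kernel₂ IsPeriodic₂ Decay₂ RowBound compKer periodise₂ imageShift imageShift_injective imageShift_sub_imageShift
    siteOf_imageShift periodise₂_eq_tsum_of_rep)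
open Literature.MathematicalPhysics.QuantumFieldTheory.Balaban1983to89.Beta.RemainderDecay190SectGTorus (hdist_torusGeom)
open Literature.MathematicalPhysics.QuantumFieldTheory.Balaban1983to89.Beta.RemainderRowSum (hrow_torusGeom)
open Literature.MathematicalPhysics.QuantumFieldTheory.Balaban1983to89.Beta.RemainderDecay190Dictionary
  (pl1_le_tdist1_finOfVal tdist1_finOfVal_eq_pl1 loc_ofBlocks_single_le_one unitFieldsLocalised_single)
open Literature.MathematicalPhysics.QuantumFieldTheory.Balaban1983to89.Beta.RemainderDecay190SupNorm
  (normDominated_restrictC_ofBlocks)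
open Literature.MathematicalPhysics.QuantumFieldTheory.Balaban1983to89.Beta.RemainderKernelPeriodised (entry_eq182)
open Literature.MathematicalPhysics.QuantumFieldTheory.Balaban1983to89.Beta.RemainderKernelDecay (decay₂_eq182)

variable {d : ℕ}

/-! ## 1. The periodisation of a decaying ℤ^d kernel decays in the periodic ℓ¹ distance of the torus -/

section Periodise

variable {s : ℕ} [NeZero s] {K : Kernel₂ d} {C δ : ℝ}

/-- **IMAGES COST HALF THE RATE**: a block-periodic ℤ^d kernel with `|K(x,y)| ≤ C e^{−δ|x−y|₁}`, `δ > 0`, has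
`|K̂(a,b)| ≤ C·K₁(d, δ∕2)·e^{−(δ∕2)‖a − b‖}` on the torus with `s` sites per direction, `‖·‖` the periodic ℓ¹ distance
(`B12Decay510Torus.pl1`), `K₁(d, δ∕2) = Σ_{z ∈ ℤ^d} e^{−(δ∕2)|z|₁}`: every image `x̃ − ỹ − s·n` projects to `a − b`, so it
is at least `‖a − b‖` long; the other half of the rate sums the images inside the ℤ^d sum.
[cite: Balaban1984PropagatorsI, p.36; Balaban1987RG1, (5.10) p.293] -/
theorem abs_periodise₂_le_of_decay (hK : IsPeriodic₂ s K) (hdec : Decay₂ K C δ) (hδ : 0 < δ) (a b : TPt d s) :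
    |periodise₂ s K a b| ≤ C * K₁ d (δ / 2) * Real.exp (-(δ / 2) * pl1 (a - b)) := by
  have hC : 0 ≤ C := hdec.constant_nonneg
  have hrow : ∀ x, Summable (K x) := fun x => hdec.summable_row hδ x
  have hδ2 : 0 < δ / 2 := by linarith
  -- representatives: the minimal ones
  have hr : Beta.siteOf d s (vmaVec a) = a := proj_vmaVec a
  have hq : Beta.siteOf d s (vmaVec b) = b := proj_vmaVec b
  rw [periodise₂_eq_tsum_of_rep hK hrow hr hq]
  -- every image is at least ‖a − b‖ long
  have hlen : ∀ n : Fin d → ℤ, pl1 (a - b) ≤ l1 (vmaVec a - imageShift s (vmaVec b) n) := fun n => by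
    have e : proj s (vmaVec a - imageShift s (vmaVec b) n) = a - b := by
      rw [proj_sub]
      show Beta.siteOf d s (vmaVec a) - Beta.siteOf d s (imageShift s (vmaVec b) n) = a - b
      rw [siteOf_imageShift, hr, hq]
    rw [← e]
    exact pl1_proj_le_l1 _
  -- termwise domination by the split exponential
  have hdom : ∀ n : Fin d → ℤ, |K (vmaVec a) (imageShift s (vmaVec b) n)| ≤
      C * Real.exp (-(δ / 2) * pl1 (a - b)) * Real.exp (-(δ / 2) * l1 (vmaVec a - imageShift s (vmaVec b) n)) :=
    fun n => by
      refine (hdec _ _).trans ?_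
      rw [mul_assoc, ← Real.exp_add]
      refine mul_le_mul_of_nonneg_left (Real.exp_le_exp.mpr ?_) hC
      nlinarith [hlen n, l1_nonneg (vmaVec a - imageShift s (vmaVec b) n)]
  -- the images form an injective family in ℤ^d, so their exponential sum is at most K₁(d, δ∕2)
  have hinj : Function.Injective fun n : Fin d → ℤ => vmaVec a - imageShift s (vmaVec b) n := by
    intro n m h
    exact imageShift_injective s (vmaVec b) (sub_right_injective h)
  have hsumZ : Summable fun z : Fin d → ℤ => Real.exp (-(δ / 2) * l1 z) := summable_exp_neg_l1 hδ2 d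
  have hsumI : Summable fun n : Fin d → ℤ => Real.exp (-(δ / 2) * l1 (vmaVec a - imageShift s (vmaVec b) n)) :=
    hsumZ.comp_injective hinj
  have hle : (∑' n : Fin d → ℤ, Real.exp (-(δ / 2) * l1 (vmaVec a - imageShift s (vmaVec b) n))) ≤ K₁ d (δ / 2) :=
    hsumI.tsum_le_tsum_of_inj (fun n : Fin d → ℤ => vmaVec a - imageShift s (vmaVec b) n) hinj
      (fun c _ => (Real.exp_pos _).le) (fun _ => le_rfl) hsumZ
  have hsM : Summable fun n : Fin d → ℤ =>
      C * Real.exp (-(δ / 2) * pl1 (a - b)) * Real.exp (-(δ / 2) * l1 (vmaVec a - imageShift s (vmaVec b) n)) :=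
    hsumI.mul_left _
  have hsA : Summable fun n : Fin d → ℤ => |K (vmaVec a) (imageShift s (vmaVec b) n)| :=
    Summable.of_nonneg_of_le (fun _ => abs_nonneg _) hdom hsM
  have hsK : Summable fun n : Fin d → ℤ => K (vmaVec a) (imageShift s (vmaVec b) n) := hsA.of_abs
  calc |∑' n : Fin d → ℤ, K (vmaVec a) (imageShift s (vmaVec b) n)|
      ≤ ∑' n : Fin d → ℤ, |K (vmaVec a) (imageShift s (vmaVec b) n)| := by
        have h := norm_tsum_le_tsum_norm hsK.norm
        simpa only [Real.norm_eq_abs] using h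
    _ ≤ ∑' n : Fin d → ℤ, C * Real.exp (-(δ / 2) * pl1 (a - b)) *
          Real.exp (-(δ / 2) * l1 (vmaVec a - imageShift s (vmaVec b) n)) := hsA.tsum_le_tsum hdom hsM
    _ = C * Real.exp (-(δ / 2) * pl1 (a - b)) *
          ∑' n : Fin d → ℤ, Real.exp (-(δ / 2) * l1 (vmaVec a - imageShift s (vmaVec b) n)) := tsum_mul_left
    _ ≤ C * Real.exp (-(δ / 2) * pl1 (a - b)) * K₁ d (δ / 2) :=
        mul_le_mul_of_nonneg_left hle (mul_nonneg hC (Real.exp_pos _).le)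
    _ = C * K₁ d (δ / 2) * Real.exp (-(δ / 2) * pl1 (a - b)) := by ring

end Periodise

/-! ## 2. Entry decay in the periodic distance ⟹ the (190) block majorant between the sharp cube sizes -/

section Blocks

variable {N M : ℕ} [NeZero N] [NeZero M] {η L Mg R : ℝ} {H : Prop}

/-- A linear map on the torus fields IS its matrix in the site basis: `T v a = Σ_b T(δ_b) a · v b`. [folklore]
[cite: Balaban1984PropagatorsII, (2.51) p.232] -/
theorem apply_eq_sum_single (T : Module.End ℝ (TPt d (N * M) → ℝ)) (v : TPt d (N * M) → ℝ) (a : TPt d (N * M)) :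
    T v a = ∑ b, T (Pi.single b 1) a * v b := by
  conv_lhs => rw [← Finset.univ_sum_single v]
  rw [map_sum, Finset.sum_apply]
  refine Finset.sum_congr rfl fun b _ => ?_
  have e : (Pi.single b (v b) : TPt d (N * M) → ℝ) = v b • (Pi.single b (1 : ℝ) : TPt d (N * M) → ℝ) := by
    rw [← Pi.single_smul', smul_eq_mul, mul_one]
  rw [e, map_smul, Pi.smul_apply, smul_eq_mul, mul_comm]

/-- The cube distance on the cube torus, read through the canonical identification ê in `Π_i Fin N`, is dominated by the
site distance: `d₁(ê(cube a), ê(cube b)) ≤ ‖a − b‖`. [cite: Balaban1987RG1, §0 p.257; Balaban1984PropagatorsII, (2.46) p.231] -/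
theorem tdist1_cubes_le_pl1 (a b : TPt d (N * M)) :
    tdist1 (fun _ : Fin d => N)
        (fun i => (⟨(tcubeOf N M a i).val, ZMod.val_lt (tcubeOf N M a i)⟩ : Fin N))
        (fun i => (⟨(tcubeOf N M b i).val, ZMod.val_lt (tcubeOf N M b i)⟩ : Fin N)) ≤ pl1 (a - b) := by
  rw [tdist1_finOfVal_eq_pl1]
  exact (pl1_tcubeOf_sub_le_distCT a (tcubeOf N M b)).trans (distCT_le rfl)

/-- **ENTRY DECAY ⟹ THE (190) BLOCK MAJORANT.**  On the cube torus (cubes of side `M` of the torus with `N·M` sites per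
direction, blocks read in `Π_i Fin N` through ê), an operator `T` on the real torus fields whose entries decay in the
periodic ℓ¹ distance, `|T(δ_b)(a)| ≤ C₁ e^{−ρ‖a − b‖}` with `ρ > 0`, `C₁ ≥ 0`, has the block majorant
`C₁·K₁(d, ρ∕2)·e^{−(ρ∕2)·d₁(y,y′)}` between the sharp cube sup-sizes `BlockNorm.ofBlocks` ([3] (2.51): *"|(Tλ)(x)| ≤
K(y, y′)|λ|, x ∈ B(y), supp λ ⊂ B(y′)"*): half the rate converts site distance into cube distance (`tdist1_cubes_le_pl1`),
the other half sums the row over the source cube (`sum_exp_pl1_le_K₁`).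
[cite: Balaban1984PropagatorsII, (2.51) p.232, (2.46) p.231; Balaban1985Variational, (190) p.308] -/
theorem hasMaj_ofBlocks_cubes_of_entry_decay (T : Module.End ℝ (TPt d (N * M) → ℝ)) {C₁ ρ : ℝ} (hC₁ : 0 ≤ C₁)
    (hρ : 0 < ρ) (hT : ∀ a b : TPt d (N * M), |T (Pi.single b 1) a| ≤ C₁ * Real.exp (-ρ * pl1 (a - b))) :
    HasMaj
      (BlockNorm.ofBlocks (toB6 (torusGeom (fun _ : Fin d => N) η L Mg) R H)
        (fun x : TPt d (N * M) => fun i => (⟨(tcubeOf N M x i).val, ZMod.val_lt (tcubeOf N M x i)⟩ : Fin N)))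
      (BlockNorm.ofBlocks (toB6 (torusGeom (fun _ : Fin d => N) η L Mg) R H)
        (fun x : TPt d (N * M) => fun i => (⟨(tcubeOf N M x i).val, ZMod.val_lt (tcubeOf N M x i)⟩ : Fin N)))
      T (fun y y' => C₁ * K₁ d (ρ / 2) * Real.exp (-(ρ / 2 * tdist1 (fun _ : Fin d => N) y y'))) := by
  classical
  have hρ2 : 0 < ρ / 2 := by linarith
  have hK₁ : 0 ≤ K₁ d (ρ / 2) := K₁_nonneg d _
  refine hasMaj_of_hasMajorant (g := toB6 (torusGeom (fun _ : Fin d => N) η L Mg) R H) _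
    (fun _ _ => mul_nonneg (mul_nonneg hC₁ hK₁) (Real.exp_pos _).le) ?_
  intro y' μ B hμ x
  -- the row at x against μ: only the source cube y′ contributes, each entry split into two half-rate factors
  have hterm : ∀ b : TPt d (N * M), |T (Pi.single b 1) x * μ b| ≤
      C₁ * Real.exp (-(ρ / 2 * tdist1 (fun _ : Fin d => N)
        (fun i => (⟨(tcubeOf N M x i).val, ZMod.val_lt (tcubeOf N M x i)⟩ : Fin N)) y')) * B *
        Real.exp (-(ρ / 2) * pl1 (x - b)) := fun b => by
    by_cases hb : (fun i => (⟨(tcubeOf N M b i).val, ZMod.val_lt (tcubeOf N M b i)⟩ : Fin N)) = y'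
    · rw [abs_mul]
      have h1 := hT x b
      have h2 := hμ.bound b hb
      have hsplit : C₁ * Real.exp (-ρ * pl1 (x - b)) ≤
          C₁ * Real.exp (-(ρ / 2 * tdist1 (fun _ : Fin d => N)
            (fun i => (⟨(tcubeOf N M x i).val, ZMod.val_lt (tcubeOf N M x i)⟩ : Fin N)) y')) *
            Real.exp (-(ρ / 2) * pl1 (x - b)) := by
        rw [mul_assoc, ← Real.exp_add]
        refine mul_le_mul_of_nonneg_left (Real.exp_le_exp.mpr ?_) hC₁
        have hd := tdist1_cubes_le_pl1 (N := N) (M := M) x b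
        rw [hb] at hd
        nlinarith [hd, pl1_nonneg (x - b)]
      calc |T (Pi.single b 1) x| * |μ b| ≤ (C₁ * Real.exp (-ρ * pl1 (x - b))) * B :=
            mul_le_mul h1 h2 (abs_nonneg _) (mul_nonneg hC₁ (Real.exp_pos _).le)
        _ ≤ _ := by
            have hB := hμ.nonneg
            nlinarith [hsplit, hB, Real.exp_pos (-(ρ / 2) * pl1 (x - b))]
    · rw [hμ.off b hb, mul_zero, abs_zero]
      exact mul_nonneg (mul_nonneg (mul_nonneg hC₁ (Real.exp_pos _).le) hμ.nonneg) (Real.exp_pos _).le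
  -- the torus sum of the half-rate exponential, re-based at x
  have hsum : ∑ b : TPt d (N * M), Real.exp (-(ρ / 2) * pl1 (x - b)) ≤ K₁ d (ρ / 2) := by
    have e : ∑ b : TPt d (N * M), Real.exp (-(ρ / 2) * pl1 (x - b)) =
        ∑ w : TPt d (N * M), Real.exp (-(ρ / 2) * pl1 w) :=
      Fintype.sum_equiv (Equiv.subLeft x) _ _ fun b => rfl
    rw [e]
    exact sum_exp_pl1_le_K₁ hρ2
  rw [apply_eq_sum_single T μ x]
  calc |∑ b, T (Pi.single b 1) x * μ b| ≤ ∑ b, |T (Pi.single b 1) x * μ b| := Finset.abs_sum_le_sum_abs _ _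
    _ ≤ ∑ b, C₁ * Real.exp (-(ρ / 2 * tdist1 (fun _ : Fin d => N)
          (fun i => (⟨(tcubeOf N M x i).val, ZMod.val_lt (tcubeOf N M x i)⟩ : Fin N)) y')) * B *
          Real.exp (-(ρ / 2) * pl1 (x - b)) := Finset.sum_le_sum fun b _ => hterm b
    _ = C₁ * Real.exp (-(ρ / 2 * tdist1 (fun _ : Fin d => N)
          (fun i => (⟨(tcubeOf N M x i).val, ZMod.val_lt (tcubeOf N M x i)⟩ : Fin N)) y')) * B *
          ∑ b, Real.exp (-(ρ / 2) * pl1 (x - b)) := by rw [Finset.mul_sum]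
    _ ≤ C₁ * Real.exp (-(ρ / 2 * tdist1 (fun _ : Fin d => N)
          (fun i => (⟨(tcubeOf N M x i).val, ZMod.val_lt (tcubeOf N M x i)⟩ : Fin N)) y')) * B * K₁ d (ρ / 2) :=
        mul_le_mul_of_nonneg_left hsum (mul_nonneg (mul_nonneg hC₁ (Real.exp_pos _).le) hμ.nonneg)
    _ = C₁ * K₁ d (ρ / 2) * Real.exp (-(ρ / 2 * tdist1 (fun _ : Fin d => N)
          (fun i => (⟨(tcubeOf N M x i).val, ZMod.val_lt (tcubeOf N M x i)⟩ : Fin N)) y')) * B := by ring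

/-- **… READ AS THE (190) LETTER**: with `δ15 ≤ 4ρ` and `C₁·K₁(d, ρ∕2) ≤ Cst` the block majorant of
`hasMaj_ofBlocks_cubes_of_entry_decay` is an `Ineq190 … Cst δ15` (majorant `Cst·e^{−⅛δ15·d₁(y,y′)}`) between the sharp
cube sizes — the type of `Data190.h190` on the cube-torus carrier. [cite: Balaban1985Variational, (190) p.308] -/
theorem ineq190_ofBlocks_cubes_of_entry_decay (T : Module.End ℝ (TPt d (N * M) → ℝ)) {C₁ ρ Cst δ15 : ℝ}
    (hC₁ : 0 ≤ C₁) (hρ : 0 < ρ) (hT : ∀ a b : TPt d (N * M), |T (Pi.single b 1) a| ≤ C₁ * Real.exp (-ρ * pl1 (a - b)))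
    (hδ15 : δ15 ≤ 4 * ρ) (hCst : C₁ * K₁ d (ρ / 2) ≤ Cst) :
    Ineq190
      (BlockNorm.ofBlocks (toB6 (torusGeom (fun _ : Fin d => N) η L Mg) R H)
        (fun x : TPt d (N * M) => fun i => (⟨(tcubeOf N M x i).val, ZMod.val_lt (tcubeOf N M x i)⟩ : Fin N)))
      (BlockNorm.ofBlocks (toB6 (torusGeom (fun _ : Fin d => N) η L Mg) R H)
        (fun x : TPt d (N * M) => fun i => (⟨(tcubeOf N M x i).val, ZMod.val_lt (tcubeOf N M x i)⟩ : Fin N)))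
      T Cst δ15 := by
  refine (hasMaj_ofBlocks_cubes_of_entry_decay (η := η) (L := L) (Mg := Mg) (R := R) (H := H) T hC₁ hρ hT).mono
    fun y y' => ?_
  have hd : 0 ≤ tdist1 (fun _ : Fin d => N) y y' := tdist1_nonneg y y'
  have hK₁ : 0 ≤ K₁ d (ρ / 2) := K₁_nonneg d _
  show C₁ * K₁ d (ρ / 2) * Real.exp (-(ρ / 2 * tdist1 (fun _ : Fin d => N) y y')) ≤
    Cst * Real.exp (-(δ15 / 8 * (toB6 (torusGeom (fun _ : Fin d => N) η L Mg) R H).dist y y'))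
  have hdist : (toB6 (torusGeom (fun _ : Fin d => N) η L Mg) R H).dist y y' = tdist1 (fun _ : Fin d => N) y y' := rfl
  rw [hdist]
  exact mul_le_mul hCst (Real.exp_le_exp.mpr (by nlinarith)) (Real.exp_pos _).le
    ((mul_nonneg hC₁ hK₁).trans hCst)

end Blocks

/-! ## 3. THE (190)-SOCKET ON THE MODEL FROM ONE ENTRYWISE DECAY STATEMENT — no Sect. G letter -/

section Socket

variable {Mc : ℕ} [NeZero Mc] {N : ℕ → ℕ} [∀ n, NeZero (N n)] {q : Consts190}

/-- **JOIN CERTIFICATE WITHOUT SECT. G LETTERS.**  On the cube-torus block carrier of generations 93–94 (block torus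
`UT (fun _ => N n)` = the cube torus read in `Π_i Fin (N n)` through ê; B-data AND configurations := real fields on the
fine torus `TPt d (N n·M)` with the sharp cube sup-sizes; (4.4)-space `Wn n := TPt d (N n·M) → ℂ` with the sup norm,
identification = restriction to the cubes of X̄ complexified; δ source fields) the (190)-socket
`Data190 d M N (fun n => TPt d (N n·M) → ℂ) q` is INHABITED from: a kernel family `dH n` whose ENTRIES DECAY in the
periodic ℓ¹ distance, `|dH n(δ_b)(a)| ≤ C₁ e^{−ρ‖a − b‖}` on every torus (`ρ > 0`, `C₁ ≥ 0`), and NUMERICS — `0 < q.σ`,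
a row-sum reference rate `δr > 0` with `c₀(q.σ∕δr)^d ≤ q.cR` ([3] (2.61)), `1 ≤ q.κB`, `1 ≤ q.m`, `0 ≤ q.θ`, `q.θ·M ≤ 1`,
`q.δ15 ≤ 4ρ`, `C₁·K₁(d, ρ∕2) ≤ q.Cst`; the (4.35) computation rule is exposed as in generation 94:
`D.hn n X̄ x = (x′ ↦ cube x′ ∈ X̄ ? ((dH n δ_x) x′ : ℂ) : 0)` (the weights `η L Mg R H` of the block-torus geometry record are free
parameters — the sharp cube sizes and `d₁` do not read them).  `h190` by §2; `hdist` ∕ `hrow` ∕ `hκB` ∕ `hdom` ∕ `hm` ∕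
`hD` exactly as generation 94 (`hdist_torusGeom`, `hrow_torusGeom`, `normDominated_restrictC_ofBlocks`,
`loc_ofBlocks_single_le_one`, `unitFieldsLocalised_single`).  Nothing of Bałaban's is constructed.
[cite: Balaban1985Variational, (190) p.308; Balaban1987RG1, (4.4) p.281 and p.282; Balaban1984PropagatorsII, (2.46) p.231, (2.51) p.232, (2.61) p.234] -/
theorem exists_data190_of_entry_cubes_supNorm (I : Type) (i₀ : I) (η L Mg R : ℕ → ℝ) (H : ℕ → Prop)
    (dH : (n : ℕ) → (TPt d (N n * Mc) → ℝ) →ₗ[ℝ] (TPt d (N n * Mc) → ℝ)) {C₁ ρ δr : ℝ}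
    (hC₁ : 0 ≤ C₁) (hρ : 0 < ρ)
    (hT : ∀ n (a b : TPt d (N n * Mc)), |dH n (Pi.single b 1) a| ≤ C₁ * Real.exp (-ρ * pl1 (a - b)))
    (hδr : 0 < δr) (hσ₀ : 0 < q.σ) (hcR : B6.c0 δr (q.σ / δr) ^ d ≤ q.cR) (hκB : 1 ≤ q.κB)
    (hδ15 : q.δ15 ≤ 4 * ρ) (hCst : C₁ * K₁ d (ρ / 2) ≤ q.Cst) (hm : 1 ≤ q.m) (hθ : 0 ≤ q.θ) (hθM : q.θ * Mc ≤ 1) :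
    ∃ D : Data190 d Mc N (fun n => TPt d (N n * Mc) → ℂ) q,
      ∀ (n : ℕ) (X : TDom d (N n)) (x : TPt d (N n * Mc)),
        D.hn n X x = fun x' : TPt d (N n * Mc) =>
          if tcubeOf (N n) Mc x' ∈ X.1 then ((dH n (Pi.single x (1 : ℝ)) x' : ℝ) : ℂ) else 0 :=
  ⟨{ I := I, gn := fun n => toB6 (torusGeom (fun _ : Fin d => N n) (η n) (L n) (Mg n)) (R n) (H n),
     FBn := fun n => TPt d (N n * Mc) → ℝ, FAn := fun n => TPt d (N n * Mc) → ℝ,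
     bBn := fun n => BlockNorm.ofBlocks (toB6 (torusGeom (fun _ : Fin d => N n) (η n) (L n) (Mg n)) (R n) (H n))
       (fun x : TPt d (N n * Mc) => fun i =>
         (⟨(tcubeOf (N n) Mc x i).val, ZMod.val_lt (tcubeOf (N n) Mc x i)⟩ : Fin (N n))),
     boutn := fun n _ => BlockNorm.ofBlocks (toB6 (torusGeom (fun _ : Fin d => N n) (η n) (L n) (Mg n)) (R n) (H n))
       (fun x : TPt d (N n * Mc) => fun i =>
         (⟨(tcubeOf (N n) Mc x i).val, ZMod.val_lt (tcubeOf (N n) Mc x i)⟩ : Fin (N n))),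
     dHn := dH,
     blkn := fun n X => (X.1.image fun a : TPt d (N n) => fun i => (⟨(a i).val, ZMod.val_lt (a i)⟩ : Fin (N n)) :
       Finset (UT (fun _ : Fin d => N n))),
     ιn := fun n X A x => if tcubeOf (N n) Mc x ∈ X.1 then ((A x : ℝ) : ℂ) else 0,
     un := fun _ x => Pi.single x (1 : ℝ),
     h190 := fun n _ => ineq190_ofBlocks_cubes_of_entry_decay (dH n) hC₁ hρ (hT n) hδ15 hCst,
     hdist := hdist_torusGeom (fun n (_ : Fin d) => N n) η L Mg R H,
     hrow := hrow_torusGeom (fun n (_ : Fin d) => N n) η L Mg R H hδr hσ₀ hcR,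
     hκB := fun _ => hκB,
     hdom := fun n => by
       letI : DecidableEq (toB6 (torusGeom (fun _ : Fin d => N n) (η n) (L n) (Mg n)) (R n) (H n)).Site :=
         inferInstanceAs (DecidableEq (UT (fun _ : Fin d => N n)))
       exact normDominated_restrictC_ofBlocks
         (g := toB6 (torusGeom (fun _ : Fin d => N n) (η n) (L n) (Mg n)) (R n) (H n)) _ i₀,
     hm := fun n x y' => (loc_ofBlocks_single_le_one
       (g := toB6 (torusGeom (fun _ : Fin d => N n) (η n) (L n) (Mg n)) (R n) (H n)) _ x y').trans hm,
     hD := fun n => unitFieldsLocalised_single (Nf := fun _ : Fin d => N n)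
       (fun a : TPt d (N n) => fun i => (⟨(a i).val, ZMod.val_lt (a i)⟩ : Fin (N n))) pl1_le_tdist1_finOfVal hθ hθM },
    fun _ _ _ => rfl⟩

end Socket

/-! ## 4. … from ONE periodised decaying kernel, and from FOUR periodised decaying pieces assembled by (182) -/

section Pieces

variable {Mc : ℕ} [NeZero Mc] {N : ℕ → ℕ} [∀ n, NeZero (N n)] {q : Consts190}

/-- **THE (190)-SOCKET ON THE MODEL FROM ONE PERIODISED DECAYING KERNEL**: if every `dH n` acts entrywise as the
periodisation of ONE ℤ^d kernel `S` with `|S(x,y)| ≤ C e^{−δ|x−y|₁}` (`δ > 0`) that is block-periodic under every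
`N n·M`, then §1 gives the entry decay at rate `δ∕2` with constant `C·K₁(d, δ∕2)`, and §3 inhabits the socket under the
numerics `q.δ15 ≤ 2δ`, `C·K₁(d, δ∕2)·K₁(d, δ∕4) ≤ q.Cst` (+ the carrier numerics).  The (5.10)-type datum of NODE E (`RemainderDecay190SupNormLimit` ∕ `…SupNormLeaves`: `hS`, `hdec`, `hker`)
thus ALSO feeds NODE D. [cite: Balaban1985Variational, (190) p.308; Balaban1987RG1, (5.10) p.293, p.282; Balaban1984PropagatorsI, p.36] -/
theorem exists_data190_of_periodised_cubes_supNorm (I : Type) (i₀ : I) (η L Mg R : ℕ → ℝ) (H : ℕ → Prop)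
    (dH : (n : ℕ) → (TPt d (N n * Mc) → ℝ) →ₗ[ℝ] (TPt d (N n * Mc) → ℝ)) {S : Kernel₂ d} {C δ δr : ℝ}
    (hS : ∀ n, IsPeriodic₂ (N n * Mc) S) (hdec : Decay₂ S C δ) (hδ : 0 < δ)
    (hent : ∀ n (a b : TPt d (N n * Mc)), dH n (Pi.single b 1) a = periodise₂ (N n * Mc) S a b)
    (hδr : 0 < δr) (hσ₀ : 0 < q.σ) (hcR : B6.c0 δr (q.σ / δr) ^ d ≤ q.cR) (hκB : 1 ≤ q.κB)
    (hδ15 : q.δ15 ≤ 2 * δ) (hCst : C * K₁ d (δ / 2) * K₁ d (δ / 4) ≤ q.Cst) (hm : 1 ≤ q.m) (hθ : 0 ≤ q.θ)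
    (hθM : q.θ * Mc ≤ 1) :
    ∃ D : Data190 d Mc N (fun n => TPt d (N n * Mc) → ℂ) q,
      ∀ (n : ℕ) (X : TDom d (N n)) (x : TPt d (N n * Mc)),
        D.hn n X x = fun x' : TPt d (N n * Mc) =>
          if tcubeOf (N n) Mc x' ∈ X.1 then ((dH n (Pi.single x (1 : ℝ)) x' : ℝ) : ℂ) else 0 := by
  have hC : 0 ≤ C := hdec.constant_nonneg
  have hδ24 : δ / 2 / 2 = δ / 4 := by ring
  refine exists_data190_of_entry_cubes_supNorm I i₀ η L Mg R H dH (C₁ := C * K₁ d (δ / 2)) (ρ := δ / 2)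
    (mul_nonneg hC (K₁_nonneg d _)) (by linarith) (fun n a b => ?_) hδr hσ₀ hcR hκB (by linarith)
    (by rw [hδ24]; exact hCst) hm hθ hθM
  rw [hent]
  exact abs_periodise₂_le_of_decay (hS n) hdec hδ a b

/-- **THE (190)-SOCKET ON THE MODEL FROM FOUR PERIODISED DECAYING PIECES ASSEMBLED BY (182)** — NODE D fed by the SAME
datum as NODE E's `RemainderDecay190SupNormPieces.letters_of_pieces182`: four ℤ^d kernels `a₀ h₀ h 𝔡` decaying at a
common rate `δ₀ > 0` and block-periodic under every `N n·M`, four operator families acting entrywise as their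
periodisations, (182) for `dH n`; numerics `q.δ15 ≤ δ₀∕2`, `C′·K₁(d, δ₀∕8)·K₁(d, δ₀∕16) ≤ q.Cst` with `C′` the constant of
`RemainderKernelDecay.decay₂_eq182` (+ the carrier numerics).  HONEST: the decay of the piece `a₀` is an INPUT here —
in [15] it is the OUTPUT of (184) + (188) + the author-omitted (189); nothing of (189) is discharged.
[cite: Balaban1985Variational, (182) p.307, (189)-(190) p.308; Balaban1987RG1, (5.10) p.293, p.282; Balaban1984PropagatorsI, p.36] -/
theorem exists_data190_of_pieces182_cubes_supNorm (I : Type) (i₀ : I) (η L Mg R : ℕ → ℝ) (H : ℕ → Prop)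
    (dH A0 H0 Hk Dfr : (n : ℕ) → (TPt d (N n * Mc) → ℝ) →ₗ[ℝ] (TPt d (N n * Mc) → ℝ))
    {a₀ h₀ h 𝔡 : Kernel₂ d} {Ca Ch₀ Ch Cd δ₀ δr : ℝ}
    (ha : Decay₂ a₀ Ca δ₀) (hh₀ : Decay₂ h₀ Ch₀ δ₀) (hh : Decay₂ h Ch δ₀) (hd : Decay₂ 𝔡 Cd δ₀) (hδ₀ : 0 < δ₀)
    (pa : ∀ n, IsPeriodic₂ (N n * Mc) a₀) (ph₀ : ∀ n, IsPeriodic₂ (N n * Mc) h₀) (ph : ∀ n, IsPeriodic₂ (N n * Mc) h)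
    (pd : ∀ n, IsPeriodic₂ (N n * Mc) 𝔡)
    (h182 : ∀ n, Eq182 (dH n) (A0 n) (H0 n) (Hk n) (Dfr n))
    (hA0 : ∀ n (a b : TPt d (N n * Mc)), A0 n (Pi.single b 1) a = periodise₂ (N n * Mc) a₀ a b)
    (hH0 : ∀ n (a b : TPt d (N n * Mc)), H0 n (Pi.single b 1) a = periodise₂ (N n * Mc) h₀ a b)
    (hHk : ∀ n (a b : TPt d (N n * Mc)), Hk n (Pi.single b 1) a = periodise₂ (N n * Mc) h a b)
    (hDfr : ∀ n (a b : TPt d (N n * Mc)), Dfr n (Pi.single b 1) a = periodise₂ (N n * Mc) 𝔡 a b)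
    (hδr : 0 < δr) (hσ₀ : 0 < q.σ) (hcR : B6.c0 δr (q.σ / δr) ^ d ≤ q.cR) (hκB : 1 ≤ q.κB)
    (hδ15 : q.δ15 ≤ δ₀ / 2)
    (hCst : ((Ca + Ch₀) + |(-1 : ℝ)| *
        (Ch * (Cd * (Ca + Ch₀) * ∑' w : Fin d → ℤ, Real.exp (-(δ₀ - δ₀ / 2) * l1 w)) *
          ∑' w : Fin d → ℤ, Real.exp (-(δ₀ / 2 - δ₀ / 4) * l1 w))) * K₁ d (δ₀ / 8) * K₁ d (δ₀ / 16) ≤ q.Cst)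
    (hm : 1 ≤ q.m) (hθ : 0 ≤ q.θ) (hθM : q.θ * Mc ≤ 1) :
    ∃ D : Data190 d Mc N (fun n => TPt d (N n * Mc) → ℂ) q,
      ∀ (n : ℕ) (X : TDom d (N n)) (x : TPt d (N n * Mc)),
        D.hn n X x = fun x' : TPt d (N n * Mc) =>
          if tcubeOf (N n) Mc x' ∈ X.1 then ((dH n (Pi.single x (1 : ℝ)) x' : ℝ) : ℂ) else 0 := by
  have E := fun n => entry_eq182 (h182 n) (hA0 n) (hH0 n) (hHk n) (hDfr n) (pa n) (ph₀ n) (ph n) (pd n)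
    (ha.rowBound hδ₀) (hh₀.rowBound hδ₀) (hh.rowBound hδ₀) (hd.rowBound hδ₀)
  have e8 : δ₀ / 4 / 2 = δ₀ / 8 := by ring
  have e16 : δ₀ / 4 / 4 = δ₀ / 16 := by ring
  exact exists_data190_of_periodised_cubes_supNorm I i₀ η L Mg R H dH (fun n => (E n).2.1) (decay₂_eq182 ha hh₀ hh hd hδ₀)
    (by linarith) (fun n a b => (E n).1 a b) hδr hσ₀ hcR hκB (by linarith) (by rw [e8, e16]; exact hCst) hm hθ hθM

end Pieces

end Literature.MathematicalPhysics.QuantumFieldTheory.Balaban1983to89.Beta.RemainderDecay190Periodised
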